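import Mathlib
import Summits.MatrixMultiplication.MatrixMultiplication.Theses.HiddenToeplitzCorners
import Literature.Computability.AlgebraicComplexity.ArithCircuitProofs
import Literature.Computability.AlgebraicComplexity.MatMulTotalComplexityProofs
import Literature.Computability.AlgebraicComplexity.FastFourierTransform
import Literature.Computability.AlgebraicComplexity.DivisionSLP
import Literature.LinearAlgebra.Matrix.CauchyDeterminant
import Literature.LinearAlgebra.Matrix.CauchyLike
import Summits.MatrixMultiplication.MatrixMultiplication.Theorems.HiddenToeplitzCornersToeplitzLikeDetCostPairs
import Summits.MatrixMultiplication.MatrixMultiplication.Theorems.HiddenToeplitzCornersToeplitzLikeDetCostPolyMulCost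
import Summits.MatrixMultiplication.MatrixMultiplication.Theorems.HiddenToeplitzCornersToeplitzLikeDetCostCauchyMatvec
import Summits.MatrixMultiplication.MatrixMultiplication.Theorems.HiddenToeplitzCornersToeplitzLikeDetCostCauchyAlgebra

/-!
# Skeleton v2 (line `Sketch`, lead) for crux `HiddenToeplitzCorners.ToeplitzLikeDetCost`
# (stmt-MatrixMultiplication-7491)

Wave 1 landed `stub_pairs` (p105764), `stub_polyMulCost` (p106263), `stub_cauchyMatvec` (p106060),
`stub_cauchyAlgebra` (p106227) — imported above; `stub_mba` and `stub_conversion` are proved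
(aux files p107178/p107188/p107191 landed) and land as soon as the farm has built their aux
modules (kept as `sorry` stubs here until then). The lead's `stub_assembly` is RESHAPED into five registered stubs:
`stub_pencilPad` (R-level algebra of the pencil: nilpotent Stein operator, identity-first padding
with free generators, the pencil's Stein equation, the linear-form program of length `s`,
entrywise evaluation), `stub_normalise` (free-constant normalisation on the Cauchy grids, K-level),
`stub_evalTransfer` (`R → K` transfer of principal minors and determinants; Cauchy matrices are
nonsingular), `stub_core` (held by the lead: the non-degenerate case with explicit constants) and
`stub_final` (degenerate cases + `ε`-bookkeeping). `fftCost` stays proved glue; the composition is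
`ToeplitzLikeDetCost_of`.
-/

set_option linter.dupNamespace false
set_option linter.unusedVariables false

namespace Summit.MatrixMultiplication.MatrixMultiplication.Theorems

open scoped BigOperators Matrix
open Literature.Computability.AlgebraicComplexity Literature.LinearAlgebra.Matrix
open Literature.Computability.AlgebraicComplexity.ArithCircuit (FanInTwoSeq freeInputs)
open Summit.MatrixMultiplication.MatrixMultiplication.Theses.HiddenToeplitzCorners (ToeplitzLikeDetCost)

noncomputable section
section KLevel

variable {K : Type} [Field K] [Algebra ℂ K]

/-! ## K-level glue (proved): the cost of the radix-2 FFT -/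

/-- **Cost of the FFT** (GG Thm 8.15, cost half, in the `Derivable` model where one butterfly output
`u ± ω^l v` is ONE linear step): all `2^κ` outputs `fft κ ω a j` of the tree's radix-2
decimation-in-frequency FFT are derivable from the inputs `a i` (`i < 2^κ`) in `κ · 2^κ` steps, for
any constant `ω`. Induction on `κ` along the definition of `fft`. [cite: GathenGerhard2013, §8.2 Thm 8.15] -/
theorem fftCost (κ : ℕ) : ∀ (ω : ℂ) (a : ℕ → K) (A : Set K),
    (∀ i < 2 ^ κ, a i ∈ A ∪ Set.range (algebraMap ℂ K)) →
    Derivable ℂ (κ * 2 ^ κ) A {v | ∃ j < 2 ^ κ, v = fft κ (algebraMap ℂ K ω) a j} := by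
  induction κ with
  | zero =>
    intro ω a A ha
    refine Derivable.of_subset ?_ _
    rintro v ⟨j, hj, rfl⟩
    have hj0 : j = 0 := by omega
    subst hj0
    simpa [fft] using ha 0 (by norm_num)
  | succ κ ih =>
    intro ω a A ha
    set ωK : K := algebraMap ℂ K ω with hωK
    -- the two half-length inputs of the recursive calls
    set b : ℕ → K := fun l => a l + a (2 ^ κ + l) with hb
    set c : ℕ → K := fun l => (a l - a (2 ^ κ + l)) * ωK ^ l with hc
    -- step 1: all `b l`, `c l` (`l < 2^κ`) in `2 · 2^κ` linear steps
    have hB : Derivable ℂ (2 ^ κ) A {v | ∃ l < 2 ^ κ, v = b l} := by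
      have h := Derivable.biUnion (k := ℂ) (Finset.range (2 ^ κ)) (c := fun _ => 1) (A := A)
        (B := fun l => {b l}) (fun l hl => by
          have hl' := Finset.mem_range.1 hl
          simpa [hb] using Derivable.add (k := ℂ) (A := A) (ha l (by rw [pow_succ]; omega))
            (ha (2 ^ κ + l) (by rw [pow_succ]; omega)))
      refine h.mono (by simp) le_rfl ?_
      rintro v ⟨l, hl, rfl⟩
      exact Set.mem_biUnion (Finset.mem_range.2 hl) rfl
    have hC : Derivable ℂ (2 ^ κ) A {v | ∃ l < 2 ^ κ, v = c l} := by
      have h := Derivable.biUnion (k := ℂ) (Finset.range (2 ^ κ)) (c := fun _ => 1) (A := A)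
        (B := fun l => {c l}) (fun l hl => by
          have hl' := Finset.mem_range.1 hl
          have h1 := Derivable.lin (k := ℂ) (A := A) (ha l (by rw [pow_succ]; omega))
            (ha (2 ^ κ + l) (by rw [pow_succ]; omega)) (ω ^ l) (-(ω ^ l))
          have : (ω ^ l) • a l + (-(ω ^ l)) • a (2 ^ κ + l) = c l := by
            simp only [hc, hωK, Algebra.smul_def, map_pow, map_neg]
            ring
          rwa [this] at h1)
      refine h.mono (by simp) le_rfl ?_
      rintro v ⟨l, hl, rfl⟩
      exact Set.mem_biUnion (Finset.mem_range.2 hl) rfl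
    have hBC : Derivable ℂ (2 ^ κ + 2 ^ κ) A ({v | ∃ l < 2 ^ κ, v = b l} ∪ {v | ∃ l < 2 ^ κ, v = c l}) :=
      hB.union hC
    -- step 2: the two recursive transforms with `ω²`
    set A' : Set K := A ∪ ({v | ∃ l < 2 ^ κ, v = b l} ∪ {v | ∃ l < 2 ^ κ, v = c l}) with hA'
    have hω2 : algebraMap ℂ K (ω * ω) = ωK * ωK := by rw [map_mul]
    have ihb := ih (ω * ω) b A' (fun i hi => Or.inl (Or.inr (Or.inl ⟨i, hi, rfl⟩)))
    have ihc := ih (ω * ω) c A' (fun i hi => Or.inl (Or.inr (Or.inr ⟨i, hi, rfl⟩)))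
    rw [hω2] at ihb ihc
    have hrec := ihb.union ihc
    have htot := hBC.trans hrec
    refine htot.mono ?_ le_rfl ?_
    · rw [pow_succ]; ring_nf; omega
    · rintro v ⟨j, hj, rfl⟩
      have hj2 : j / 2 < 2 ^ κ := by rw [pow_succ] at hj; omega
      by_cases hpar : j % 2 = 0
      · left
        exact ⟨j / 2, hj2, by rw [fft, if_pos hpar]⟩
      · right
        exact ⟨j / 2, hj2, by rw [fft, if_neg hpar]⟩


/-- **Stub `conversion`** — proved in `work/stubs/Conversion.lean` (imports the landed aux files), landing as p107202. [cite: Pan2001, §4.7] -/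
theorem stub_conversion (hfft : ∀ (κ : ℕ) (ω : ℂ) (a : ℕ → K) (A : Set K),
      (∀ i < 2 ^ κ, a i ∈ A ∪ Set.range (algebraMap ℂ K)) →
      Derivable ℂ (κ * 2 ^ κ) A {v | ∃ j < 2 ^ κ, v = fft κ (algebraMap ℂ K ω) a j})
    (hpm : ∀ (n : ℕ) (u v : Fin n → K) (A : Set K),
      (∀ i, u i ∈ A ∪ Set.range (algebraMap ℂ K)) → (∀ i, v i ∈ A ∪ Set.range (algebraMap ℂ K)) →
      Derivable ℂ (16 * n * (Nat.log 2 n + 4)) A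
        {w | ∃ m : ℕ, w = ∑ i : Fin n, ∑ j : Fin n, if (i : ℕ) + j = m then u i * v j else 0}) :
    ∀ (κ β : ℕ) (ω ε φ : ℂ), IsPrimitiveRoot ω (2 ^ κ) → ε ≠ 0 → φ ≠ 0 →
      (∀ i j : ℕ, ε * ω ^ i ≠ φ * ω ^ j) →
      ∀ (T : Matrix (Fin (2 ^ κ)) (Fin (2 ^ κ)) K) (P Q : Matrix (Fin (2 ^ κ)) (Fin β) K),
      T - (Matrix.of fun i j : Fin (2 ^ κ) => if (i : ℕ) = (j : ℕ) + 1 then (1 : K) else 0) * T *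
          (Matrix.of fun i j : Fin (2 ^ κ) => if (i : ℕ) = (j : ℕ) + 1 then (1 : K) else 0)ᵀ = P * Qᵀ →
      IsUnit ((Matrix.of fun i j : Fin (2 ^ κ) => algebraMap ℂ K (ε ^ (j : ℕ) * ω ^ ((i : ℕ) * j)))).det ∧
      IsUnit ((Matrix.of fun i j : Fin (2 ^ κ) => algebraMap ℂ K (φ ^ (j : ℕ) * ω ^ ((i : ℕ) * j)))).det ∧
      cauchyLike (fun i : Fin (2 ^ κ) => algebraMap ℂ K (ε * ω ^ (i : ℕ)))
          (fun j : Fin (2 ^ κ) => algebraMap ℂ K (φ * ω ^ (j : ℕ)))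
          ((Matrix.of fun i j : Fin (2 ^ κ) => algebraMap ℂ K (ε ^ (j : ℕ) * ω ^ ((i : ℕ) * j))) *
            (Matrix.fromCols (Matrix.fromCols
            (Matrix.of fun (i : Fin (2 ^ κ)) (_ : Fin 1) =>
              ((Matrix.of fun i j : Fin (2 ^ κ) => if (i : ℕ) = (j : ℕ) + 1 then (1 : K) else 0)).mulVec
                (fun i : Fin (2 ^ κ) => ∑ k : Fin β, ∑ a : Fin (2 ^ κ), ∑ b : Fin (2 ^ κ), if (a : ℕ) + b = i then P a k * Q (Fin.rev b) k else 0) i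
              - algebraMap ℂ K (φ ^ 2 ^ κ) * (fun i : Fin (2 ^ κ) => ∑ k : Fin β, P i k * Q 0 k) i)
            (Matrix.of fun (i : Fin (2 ^ κ)) (_ : Fin 1) => if (i : ℕ) = 0 then (1 : K) else 0))
          (-P)))
          (((Matrix.of fun i j : Fin (2 ^ κ) => algebraMap ℂ K (φ ^ (j : ℕ) * ω ^ ((i : ℕ) * j)))ᵀ)⁻¹ *
            (Matrix.fromCols (Matrix.fromCols
            (Matrix.of fun (j : Fin (2 ^ κ)) (_ : Fin 1) => if (j : ℕ) = 2 ^ κ - 1 then (1 : K) else 0)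
            (Matrix.of fun (j : Fin (2 ^ κ)) (_ : Fin 1) => algebraMap ℂ K (ε ^ 2 ^ κ) *
              (fun j : Fin (2 ^ κ) => ∑ k : Fin β, ∑ a : Fin (2 ^ κ), ∑ b : Fin (2 ^ κ), if (a : ℕ) + b = j then P (Fin.rev a) k * Q b k else 0) j))
          ((Matrix.of fun i j : Fin (2 ^ κ) => if (i : ℕ) = (j : ℕ) + 1 then (1 : K) else 0)ᵀ * Q)))
        = (Matrix.of fun i j : Fin (2 ^ κ) => algebraMap ℂ K (ε ^ (j : ℕ) * ω ^ ((i : ℕ) * j))) * T *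
          ((Matrix.of fun i j : Fin (2 ^ κ) => algebraMap ℂ K (φ ^ (j : ℕ) * ω ^ ((i : ℕ) * j))))⁻¹ ∧
      ∀ (A : Set K), (∀ i k, P i k ∈ A ∪ Set.range (algebraMap ℂ K)) →
        (∀ i k, Q i k ∈ A ∪ Set.range (algebraMap ℂ K)) →
        Derivable ℂ (40 * (β + 2) * (κ + 4) * 2 ^ κ) A
          (Set.range (fun ik : Fin (2 ^ κ) × ((Fin 1 ⊕ Fin 1) ⊕ Fin β) =>
              ((Matrix.of fun i j : Fin (2 ^ κ) => algebraMap ℂ K (ε ^ (j : ℕ) * ω ^ ((i : ℕ) * j))) *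
                (Matrix.fromCols (Matrix.fromCols
            (Matrix.of fun (i : Fin (2 ^ κ)) (_ : Fin 1) =>
              ((Matrix.of fun i j : Fin (2 ^ κ) => if (i : ℕ) = (j : ℕ) + 1 then (1 : K) else 0)).mulVec
                (fun i : Fin (2 ^ κ) => ∑ k : Fin β, ∑ a : Fin (2 ^ κ), ∑ b : Fin (2 ^ κ), if (a : ℕ) + b = i then P a k * Q (Fin.rev b) k else 0) i
              - algebraMap ℂ K (φ ^ 2 ^ κ) * (fun i : Fin (2 ^ κ) => ∑ k : Fin β, P i k * Q 0 k) i)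
            (Matrix.of fun (i : Fin (2 ^ κ)) (_ : Fin 1) => if (i : ℕ) = 0 then (1 : K) else 0))
          (-P))) ik.1 ik.2) ∪
           Set.range (fun ik : Fin (2 ^ κ) × ((Fin 1 ⊕ Fin 1) ⊕ Fin β) =>
              (((Matrix.of fun i j : Fin (2 ^ κ) => algebraMap ℂ K (φ ^ (j : ℕ) * ω ^ ((i : ℕ) * j)))ᵀ)⁻¹ *
                (Matrix.fromCols (Matrix.fromCols
            (Matrix.of fun (j : Fin (2 ^ κ)) (_ : Fin 1) => if (j : ℕ) = 2 ^ κ - 1 then (1 : K) else 0)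
            (Matrix.of fun (j : Fin (2 ^ κ)) (_ : Fin 1) => algebraMap ℂ K (ε ^ 2 ^ κ) *
              (fun j : Fin (2 ^ κ) => ∑ k : Fin β, ∑ a : Fin (2 ^ κ), ∑ b : Fin (2 ^ κ), if (a : ℕ) + b = j then P (Fin.rev a) k * Q b k else 0) j))
          ((Matrix.of fun i j : Fin (2 ^ κ) => if (i : ℕ) = (j : ℕ) + 1 then (1 : K) else 0)ᵀ * Q))) ik.1 ik.2)) := by
  sorry

end KLevel

/-! ## Assembly, reshaped (wave 2): padding / normalisation / evaluation transfer / core / final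

NOTE on shapes: the gate's stub registry stores at most ~3900 characters of a signature, so every
registered statement below is kept self-contained and SHORT — stubs whose natural hypotheses are
other (landed) stubs are registered WITHOUT those hypotheses and their files import the landed
helpers instead (`…FFTCost`, `…CauchyMatvec`, `…CauchyAlgebra`, `…PolyMulCost`, `…MBA`,
`…Conversion`, …). The logical dependency is thus inside the proofs: `stub_core` uses all of
`stub_pairs`, `stub_conversion`, `stub_mba`, `stub_normalise`, `stub_evalTransfer`, `stub_pencilPad1/2`.
-/

/-- **Stub `pencilPad1`** (generic algebra of the shift): (P1) the Stein operator `A ↦ A − Z A Zᵀ` is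
injective (nilpotent shift); (P2) identity-FIRST padding `I_(n−N) ⊕ T` to size `n ≥ N ≥ 1` keeps the
Stein structure with the FREE generators `[e₀ | e_(n−N) | 0 ⊕ Gs]`, `[e₀ | −e_(n−N) | 0 ⊕ Hs]` and the
determinant. [folklore] -/
theorem stub_pencilPad1 :
    (∀ (S : Type) [CommRing S] (N : ℕ) (A : Matrix (Fin N) (Fin N) S),
        A - (Matrix.of fun i j : Fin N => if (i : ℕ) = (j : ℕ) + 1 then (1 : S) else 0) * A *
          (Matrix.of fun i j : Fin N => if (i : ℕ) = (j : ℕ) + 1 then (1 : S) else 0)ᵀ = 0 → A = 0) ∧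
    (∀ (S : Type) [CommRing S] (N n : ℕ) (hNn : N ≤ n) (q : Type) [Fintype q]
        (T : Matrix (Fin N) (Fin N) S) (Gs Hs : Matrix (Fin N) q S), 0 < N →
        T - (Matrix.of fun i j : Fin N => if (i : ℕ) = (j : ℕ) + 1 then (1 : S) else 0) * T *
          (Matrix.of fun i j : Fin N => if (i : ℕ) = (j : ℕ) + 1 then (1 : S) else 0)ᵀ = Gs * Hsᵀ →
        ((Matrix.fromBlocks (1 : Matrix (Fin (n - N)) (Fin (n - N)) S) 0 0 T).submatrix (fun i : Fin n => finSumFinEquiv.symm (i.cast (Nat.sub_add_cancel hNn).symm)) (fun i : Fin n => finSumFinEquiv.symm (i.cast (Nat.sub_add_cancel hNn).symm))) -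
          (Matrix.of fun i j : Fin n => if (i : ℕ) = (j : ℕ) + 1 then (1 : S) else 0) *
          ((Matrix.fromBlocks (1 : Matrix (Fin (n - N)) (Fin (n - N)) S) 0 0 T).submatrix (fun i : Fin n => finSumFinEquiv.symm (i.cast (Nat.sub_add_cancel hNn).symm)) (fun i : Fin n => finSumFinEquiv.symm (i.cast (Nat.sub_add_cancel hNn).symm))) *
          (Matrix.of fun i j : Fin n => if (i : ℕ) = (j : ℕ) + 1 then (1 : S) else 0)ᵀ =
          (Matrix.fromCols (Matrix.fromCols (Matrix.of fun (i : Fin n) (_ : Fin 1) => if (i : ℕ) = 0 then (1 : S) else 0)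
            (Matrix.of fun (i : Fin n) (_ : Fin 1) => if (i : ℕ) = n - N then (1 : S) else 0))
          ((Matrix.fromRows (0 : Matrix (Fin (n - N)) q S) Gs).submatrix (fun i : Fin n => finSumFinEquiv.symm (i.cast (Nat.sub_add_cancel hNn).symm)) id)) *
          (Matrix.fromCols (Matrix.fromCols (Matrix.of fun (i : Fin n) (_ : Fin 1) => if (i : ℕ) = 0 then (1 : S) else 0)
            (Matrix.of fun (i : Fin n) (_ : Fin 1) => if (i : ℕ) = n - N then (-1 : S) else 0))
          ((Matrix.fromRows (0 : Matrix (Fin (n - N)) q S) Hs).submatrix (fun i : Fin n => finSumFinEquiv.symm (i.cast (Nat.sub_add_cancel hNn).symm)) id))ᵀ ∧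
        (((Matrix.fromBlocks (1 : Matrix (Fin (n - N)) (Fin (n - N)) S) 0 0 T).submatrix (fun i : Fin n => finSumFinEquiv.symm (i.cast (Nat.sub_add_cancel hNn).symm)) (fun i : Fin n => finSumFinEquiv.symm (i.cast (Nat.sub_add_cancel hNn).symm)))).det = T.det) := by
  sorry

/-- **Stub `pencilPad2`** (the pencil over `R = ℂ[X]`): (P3) `T(X) = ∑ X_ab • T_ab` inherits the Stein
equation with generators `[G₀ | G₁(X)]`, `[H₁(X) | H₀]`; (P4) the entries of the linear forms
`G₁(X)`, `H₁(X)` are jointly computable by a fan-in-two program of length `≤ s` (sparsity);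
(P5) entrywise evaluation of a pencil. [folklore] -/
theorem stub_pencilPad2 :
    (∀ (r N d : ℕ) (T : Fin r → Fin r → Matrix (Fin N) (Fin N) ℂ) (G₀ H₀ : Matrix (Fin N) (Fin d) ℂ) (G₁ H₁ : Fin r → Fin r → Matrix (Fin N) (Fin d) ℂ),
        (∀ a b, T a b - (Matrix.of fun i j : Fin N => if (i : ℕ) = (j : ℕ) + 1 then (1 : ℂ) else 0) * T a b * (Matrix.of fun i j : Fin N => if (i : ℕ) = (j : ℕ) + 1 then (1 : ℂ) else 0)ᵀ = G₀ * (H₁ a b)ᵀ + G₁ a b * H₀ᵀ) →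
        (∑ a : Fin r, ∑ b : Fin r, (MvPolynomial.X (a, b) : MvPolynomial (Fin r × Fin r) ℂ) • (T a b).map (MvPolynomial.C : ℂ → MvPolynomial (Fin r × Fin r) ℂ)) -
          (Matrix.of fun i j : Fin N => if (i : ℕ) = (j : ℕ) + 1 then (1 : MvPolynomial (Fin r × Fin r) ℂ) else 0) *
          (∑ a : Fin r, ∑ b : Fin r, (MvPolynomial.X (a, b) : MvPolynomial (Fin r × Fin r) ℂ) • (T a b).map (MvPolynomial.C : ℂ → MvPolynomial (Fin r × Fin r) ℂ)) *
          (Matrix.of fun i j : Fin N => if (i : ℕ) = (j : ℕ) + 1 then (1 : MvPolynomial (Fin r × Fin r) ℂ) else 0)ᵀ =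
          (Matrix.fromCols (G₀.map (MvPolynomial.C : ℂ → MvPolynomial (Fin r × Fin r) ℂ)) (∑ a : Fin r, ∑ b : Fin r, (MvPolynomial.X (a, b) : MvPolynomial (Fin r × Fin r) ℂ) • (G₁ a b).map (MvPolynomial.C : ℂ → MvPolynomial (Fin r × Fin r) ℂ))) *
          (Matrix.fromCols (∑ a : Fin r, ∑ b : Fin r, (MvPolynomial.X (a, b) : MvPolynomial (Fin r × Fin r) ℂ) • (H₁ a b).map (MvPolynomial.C : ℂ → MvPolynomial (Fin r × Fin r) ℂ)) (H₀.map (MvPolynomial.C : ℂ → MvPolynomial (Fin r × Fin r) ℂ)))ᵀ) ∧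
    (∀ (r N d : ℕ) (T : Fin r → Fin r → Matrix (Fin N) (Fin N) ℂ) (G₀ H₀ : Matrix (Fin N) (Fin d) ℂ) (G₁ H₁ : Fin r → Fin r → Matrix (Fin N) (Fin d) ℂ),
        ∃ l : List (MvPolynomial (Fin r × Fin r) ℂ), FanInTwoSeq (freeInputs ℂ (Fin r × Fin r)) l ∧
          l.length ≤ (∑ a : Fin r, ∑ b : Fin r, ((Finset.univ.filter fun p : Fin N × Fin d => G₁ a b p.1 p.2 ≠ 0).card + (Finset.univ.filter fun p : Fin N × Fin d => H₁ a b p.1 p.2 ≠ 0).card)) ∧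
          (∀ i k, (∑ a : Fin r, ∑ b : Fin r, (MvPolynomial.X (a, b) : MvPolynomial (Fin r × Fin r) ℂ) • (G₁ a b).map (MvPolynomial.C : ℂ → MvPolynomial (Fin r × Fin r) ℂ)) i k ∈ freeInputs ℂ (Fin r × Fin r) ∪ {x | x ∈ l}) ∧
          (∀ i k, (∑ a : Fin r, ∑ b : Fin r, (MvPolynomial.X (a, b) : MvPolynomial (Fin r × Fin r) ℂ) • (H₁ a b).map (MvPolynomial.C : ℂ → MvPolynomial (Fin r × Fin r) ℂ)) i k ∈ freeInputs ℂ (Fin r × Fin r) ∪ {x | x ∈ l})) ∧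
    (∀ (r : ℕ) (m m' : Type) [Fintype m] [Fintype m'] (M : Fin r → Fin r → Matrix m m' ℂ) (x : Fin r × Fin r → ℂ),
        (∑ a : Fin r, ∑ b : Fin r, (MvPolynomial.X (a, b) : MvPolynomial (Fin r × Fin r) ℂ) • (M a b).map (MvPolynomial.C : ℂ → MvPolynomial (Fin r × Fin r) ℂ)).map (MvPolynomial.eval x) =
          ∑ a : Fin r, ∑ b : Fin r, x (a, b) • M a b) := by
  sorry

section KLevel2

variable {K : Type} [Field K] [Algebra ℂ K]

/-- **Stub `normalise`** (the free-constant normalisation, K-level): for the Cauchy-like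
`C₀ = cauchyLike x y G₃ H₃` on `x = ⟨ω⟩`, `y = 2⟨ω⟩` and a CONSTANT invertible Cauchy-like `B₀` on the
same grids (think `B₀ = C₀(X₀)`), the matrix `W · C₀` with `W := K'(3⟨ω⟩, 2⟨ω⟩) · B₀⁻¹` is Cauchy-like
on `3⟨ω⟩ × 2⟨ω⟩` with the explicit generator `([1 | K'(−B₀⁻¹G₃₀) | W G₃], [C₀ᵀ B₀⁻ᵀ 1 | C₀ᵀ B₀⁻ᵀ H₃₀ | H₃])`
(product rule for Sylvester displacement), and the generator entries are derivable from those of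
`G₃, H₃` by `2|p₃|+1` Cauchy-like matvecs (landed `stub_cauchyMatvec` + `fftCost`). [folklore] -/
theorem stub_normalise :
    ∀ (κ : ℕ) (ω : ℂ), IsPrimitiveRoot ω (2 ^ κ) →
      ∀ (p₃ : Type) [Fintype p₃] [DecidableEq p₃] (G₃ H₃ : Matrix (Fin (2 ^ κ)) p₃ K)
        (B₀ : Matrix (Fin (2 ^ κ)) (Fin (2 ^ κ)) ℂ) (G₃₀ H₃₀ : Matrix (Fin (2 ^ κ)) p₃ ℂ),
      B₀ = cauchyLike (fun i : Fin (2 ^ κ) => (1 : ℂ) * ω ^ (i : ℕ)) (fun j : Fin (2 ^ κ) => (2 : ℂ) * ω ^ (j : ℕ)) G₃₀ H₃₀ → IsUnit B₀.det →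
      ((cauchyLike (fun i : Fin (2 ^ κ) => (3 : ℂ) * ω ^ (i : ℕ)) (fun j : Fin (2 ^ κ) => (2 : ℂ) * ω ^ (j : ℕ)) (Matrix.of fun (_ : Fin (2 ^ κ)) (_ : Fin 1) => (1 : ℂ)) (Matrix.of fun (_ : Fin (2 ^ κ)) (_ : Fin 1) => (1 : ℂ))) * B₀⁻¹).map (algebraMap ℂ K) * (cauchyLike (fun i : Fin (2 ^ κ) => algebraMap ℂ K (1 * ω ^ (i : ℕ))) (fun j : Fin (2 ^ κ) => algebraMap ℂ K (2 * ω ^ (j : ℕ))) G₃ H₃) =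
          cauchyLike (fun i : Fin (2 ^ κ) => algebraMap ℂ K (3 * ω ^ (i : ℕ))) (fun j : Fin (2 ^ κ) => algebraMap ℂ K (2 * ω ^ (j : ℕ)))
            (Matrix.fromCols ((Matrix.fromCols (Matrix.of fun (_ : Fin (2 ^ κ)) (_ : Fin 1) => (1 : ℂ)) ((cauchyLike (fun i : Fin (2 ^ κ) => (3 : ℂ) * ω ^ (i : ℕ)) (fun j : Fin (2 ^ κ) => (2 : ℂ) * ω ^ (j : ℕ)) (Matrix.of fun (_ : Fin (2 ^ κ)) (_ : Fin 1) => (1 : ℂ)) (Matrix.of fun (_ : Fin (2 ^ κ)) (_ : Fin 1) => (1 : ℂ))) * (-(B₀⁻¹ * G₃₀)))).map (algebraMap ℂ K)) (((cauchyLike (fun i : Fin (2 ^ κ) => (3 : ℂ) * ω ^ (i : ℕ)) (fun j : Fin (2 ^ κ) => (2 : ℂ) * ω ^ (j : ℕ)) (Matrix.of fun (_ : Fin (2 ^ κ)) (_ : Fin 1) => (1 : ℂ)) (Matrix.of fun (_ : Fin (2 ^ κ)) (_ : Fin 1) => (1 : ℂ))) * B₀⁻¹).map (algebraMap ℂ K)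 * G₃))
            (Matrix.fromCols ((cauchyLike (fun i : Fin (2 ^ κ) => algebraMap ℂ K (1 * ω ^ (i : ℕ))) (fun j : Fin (2 ^ κ) => algebraMap ℂ K (2 * ω ^ (j : ℕ))) G₃ H₃)ᵀ * (Matrix.fromCols (B₀⁻¹ᵀ * (Matrix.of fun (_ : Fin (2 ^ κ)) (_ : Fin 1) => (1 : ℂ))) ((H₃₀ᵀ * B₀⁻¹)ᵀ)).map (algebraMap ℂ K)) H₃) ∧
      ∀ (A : Set K), (∀ i k, G₃ i k ∈ A ∪ Set.range (algebraMap ℂ K)) →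
        (∀ i k, H₃ i k ∈ A ∪ Set.range (algebraMap ℂ K)) →
        Derivable ℂ (2 * Fintype.card p₃ * (Fintype.card p₃ + 1) * (2 * κ + 7) * 2 ^ κ) A
          (Set.range (fun ik : Fin (2 ^ κ) × ((Fin 1 ⊕ p₃) ⊕ p₃) =>
              (Matrix.fromCols ((Matrix.fromCols (Matrix.of fun (_ : Fin (2 ^ κ)) (_ : Fin 1) => (1 : ℂ)) ((cauchyLike (fun i : Fin (2 ^ κ) => (3 : ℂ) * ω ^ (i : ℕ)) (fun j : Fin (2 ^ κ) => (2 : ℂ) * ω ^ (j : ℕ)) (Matrix.of fun (_ : Fin (2 ^ κ)) (_ : Fin 1) => (1 : ℂ)) (Matrix.of fun (_ : Fin (2 ^ κ)) (_ : Fin 1) => (1 : ℂ))) * (-(B₀⁻¹ * G₃₀)))).map (algebraMap ℂ K)) (((cauchyLike (fun i : Fin (2 ^ κ) => (3 : ℂ) * ω ^ (i : ℕ)) (fun j : Fin (2 ^ κ) => (2 : ℂ) * ω ^ (j : ℕ)) (Matrix.of fun (_ : Fin (2 ^ κ)) (_ : Fin 1) => (1 : ℂ)) (Matrix.of fun (_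 : Fin (2 ^ κ)) (_ : Fin 1) => (1 : ℂ))) * B₀⁻¹).map (algebraMap ℂ K) * G₃)) ik.1 ik.2) ∪
           Set.range (fun ik : Fin (2 ^ κ) × ((Fin 1 ⊕ p₃) ⊕ p₃) =>
              (Matrix.fromCols ((cauchyLike (fun i : Fin (2 ^ κ) => algebraMap ℂ K (1 * ω ^ (i : ℕ))) (fun j : Fin (2 ^ κ) => algebraMap ℂ K (2 * ω ^ (j : ℕ))) G₃ H₃)ᵀ * (Matrix.fromCols (B₀⁻¹ᵀ * (Matrix.of fun (_ : Fin (2 ^ κ)) (_ : Fin 1) => (1 : ℂ))) ((H₃₀ᵀ * B₀⁻¹)ᵀ)).map (algebraMap ℂ K)) H₃) ik.1 ik.2)) := by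
  sorry

/-- **Stub `mba`** (re-registered hypothesis-free; proved in `work/stubs/MBA.lean` from the landed
`stub_cauchyMatvec`, `fftCost`, `stub_cauchyAlgebra`). [cite: BitmeadAnderson1980, §3–4] -/
theorem stub_mba :
    ∀ (κ : ℕ) (ω a b : ℂ), IsPrimitiveRoot ω (2 ^ κ) → a ≠ 0 → b ≠ 0 →
      (∀ i j : ℕ, a * ω ^ i ≠ b * ω ^ j) →
      ∀ (p : Type) [Fintype p] [DecidableEq p] (G H : Matrix (Fin (2 ^ κ)) p K) (A : Set K),
      (∀ i k, G i k ∈ A ∪ Set.range (algebraMap ℂ K)) →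
      (∀ i k, H i k ∈ A ∪ Set.range (algebraMap ℂ K)) →
      (∀ (ι : Type) [Fintype ι] [DecidableEq ι] (g : ι → Fin (2 ^ κ)), Function.Injective g →
        ((cauchyLike (fun i : Fin (2 ^ κ) => algebraMap ℂ K (a * ω ^ (i : ℕ)))
            (fun j : Fin (2 ^ κ) => algebraMap ℂ K (b * ω ^ (j : ℕ))) G H).submatrix g g).det ≠ 0) →
      Derivable ℂ (64 * (Fintype.card p + 1) ^ 2 * (κ + 1) ^ 2 * 2 ^ κ) A
        ({(cauchyLike (fun i : Fin (2 ^ κ) => algebraMap ℂ K (a * ω ^ (i : ℕ)))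
            (fun j : Fin (2 ^ κ) => algebraMap ℂ K (b * ω ^ (j : ℕ))) G H).det} ∪
          Set.range (fun ik : Fin (2 ^ κ) × p =>
            ((cauchyLike (fun i : Fin (2 ^ κ) => algebraMap ℂ K (a * ω ^ (i : ℕ)))
              (fun j : Fin (2 ^ κ) => algebraMap ℂ K (b * ω ^ (j : ℕ))) G H)⁻¹ * G) ik.1 ik.2) ∪
          Set.range (fun ki : p × Fin (2 ^ κ) =>
            (Hᵀ * (cauchyLike (fun i : Fin (2 ^ κ) => algebraMap ℂ K (a * ω ^ (i : ℕ)))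
              (fun j : Fin (2 ^ κ) => algebraMap ℂ K (b * ω ^ (j : ℕ))) G H)⁻¹) ki.1 ki.2)) := by
  sorry

end KLevel2

/-- **Stub `evalTransfer`** (`R → K` transfer at `K = Frac ℂ[X]`): (E1)/(E2) for constant matrices
`M₁, M₂` (`M₂` invertible) and a polynomial matrix `T_R`, every principal minor of
`M₁ · T_R · M₂⁻¹` over `K` is nonzero as soon as its evaluation at one point `x₀` is, and
`det = M₁.det · M₂.det⁻¹ · T_R.det`; (E3) a Cauchy matrix `((u_i − v_j)⁻¹)` with distinct, disjoint
nodes is nonsingular (Cauchy 1841, by the tree's `det_cauchyMatrix_succ`). [folklore] -/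
theorem stub_evalTransfer :
    (∀ (σ : Type) [DecidableEq σ] (n : ℕ) (x0 : σ → ℂ) (TR : Matrix (Fin n) (Fin n) (MvPolynomial σ ℂ))
        (M₁ M₂ : Matrix (Fin n) (Fin n) ℂ), IsUnit M₂.det →
        (∀ (ι : Type) [Fintype ι] [DecidableEq ι] (g : ι → Fin n),
          ((M₁ * TR.map (MvPolynomial.eval x0) * M₂⁻¹).submatrix g g).det ≠ 0 →
          ((M₁.map (algebraMap ℂ (FractionRing (MvPolynomial σ ℂ))) *
              TR.map (algebraMap (MvPolynomial σ ℂ) (FractionRing (MvPolynomial σ ℂ))) *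
              (M₂.map (algebraMap ℂ (FractionRing (MvPolynomial σ ℂ))))⁻¹).submatrix g g).det ≠ 0) ∧
        (M₁.map (algebraMap ℂ (FractionRing (MvPolynomial σ ℂ))) *
            TR.map (algebraMap (MvPolynomial σ ℂ) (FractionRing (MvPolynomial σ ℂ))) *
            (M₂.map (algebraMap ℂ (FractionRing (MvPolynomial σ ℂ))))⁻¹).det =
          algebraMap ℂ (FractionRing (MvPolynomial σ ℂ)) (M₁.det * (M₂.det)⁻¹) *
            algebraMap (MvPolynomial σ ℂ) (FractionRing (MvPolynomial σ ℂ)) TR.det) ∧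
    (∀ (ι : Type) [Fintype ι] [DecidableEq ι] (u v : ι → ℂ), Function.Injective u → Function.Injective v →
        (∀ i j, u i ≠ v j) → (Matrix.of fun i j : ι => (u i - v j)⁻¹).det ≠ 0) := by
  sorry

/-- **Stub `core`** (held by the lead; hypothesis-free, proved from the landed stubs): the
non-degenerate case with explicit constants — for a pencil with Stein generators of length `d ≥ 1`,
size `N ≥ 1` and a nonsingular point `X₀`, some `Q ≠ 0` has
`complexity (Q · det T(X)) ≤ s + 4 · 10⁴ (d+1)² (log₂ N + 2)² 2^(log₂ N + 1)`: pad to `2^κ`,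
`κ = log₂ N + 1` (pencilPad1/2), convert (`stub_conversion` at `K = Frac ℂ[X]` and at `ℂ` for `X₀`),
normalise (`stub_normalise`), check the principal minors by evaluation at `X₀` (`stub_evalTransfer`:
the value is the plain Cauchy matrix `K'(3⟨ω⟩,2⟨ω⟩)`), run `stub_mba`, collect `det C = c · det T(X)`
with `c ∈ ℂˣ`, and finish with `stub_pairs`. [cite: Pan2001, Cor. 5.3.3] -/
theorem stub_core :
    ∀ (r N d : ℕ) (T : Fin r → Fin r → Matrix (Fin N) (Fin N) ℂ) (G₀ H₀ : Matrix (Fin N) (Fin d) ℂ) (G₁ H₁ : Fin r → Fin r → Matrix (Fin N) (Fin d) ℂ),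
      (∀ a b, T a b - (Matrix.of fun i j : Fin N => if (i : ℕ) = (j : ℕ) + 1 then (1 : ℂ) else 0) * T a b * (Matrix.of fun i j : Fin N => if (i : ℕ) = (j : ℕ) + 1 then (1 : ℂ) else 0)ᵀ = G₀ * (H₁ a b)ᵀ + G₁ a b * H₀ᵀ) →
      0 < N → 0 < d → (∃ X₀ : Matrix (Fin r) (Fin r) ℂ, (∑ a : Fin r, ∑ b : Fin r, X₀ a b • T a b).det ≠ 0) →
      ∃ Q : MvPolynomial (Fin r × Fin r) ℂ, Q ≠ 0 ∧
        complexity (Q * (∑ a : Fin r, ∑ b : Fin r, (MvPolynomial.X (a, b) : MvPolynomial (Fin r × Fin r) ℂ) • (T a b).map (MvPolynomial.C : ℂ → MvPolynomial (Fin r × Fin r) ℂ)).det) ≤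
          (∑ a : Fin r, ∑ b : Fin r, ((Finset.univ.filter fun p : Fin N × Fin d => G₁ a b p.1 p.2 ≠ 0).card + (Finset.univ.filter fun p : Fin N × Fin d => H₁ a b p.1 p.2 ≠ 0).card)) +
          4 * (10000 * (d + 1) ^ 2 * (Nat.log 2 N + 2) ^ 2 * 2 ^ (Nat.log 2 N + 1)) := by
  sorry

/-- **Stub `final`** (degenerate cases and the `ε`-bookkeeping): from the core bound, the nilpotency
of the Stein operator (`d = 0 ⇒ T = 0`) and entrywise evaluation of the pencil (a polynomial
determinant that is not identically zero has a nonsingular point, `MvPolynomial.funext`), the crux: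
`N = 0` or `det ≡ 0` give `Q := 1` at cost `0`; otherwise `s + 4·10⁴(d+1)²(log₂N+2)² 2^(log₂N+1)
≤ (d²N + s)·r^ε` for `r ≥ r₀(ε)` because `N ≤ r³` makes `log₂ N + 2 ≤ 4(log₂ r + 1)` and
`(log r)² = o(r^ε)`. [folklore] -/
theorem stub_final
    (hcore : ∀ (r N d : ℕ) (T : Fin r → Fin r → Matrix (Fin N) (Fin N) ℂ) (G₀ H₀ : Matrix (Fin N) (Fin d) ℂ) (G₁ H₁ : Fin r → Fin r → Matrix (Fin N) (Fin d) ℂ),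
      (∀ a b, T a b - (Matrix.of fun i j : Fin N => if (i : ℕ) = (j : ℕ) + 1 then (1 : ℂ) else 0) * T a b * (Matrix.of fun i j : Fin N => if (i : ℕ) = (j : ℕ) + 1 then (1 : ℂ) else 0)ᵀ = G₀ * (H₁ a b)ᵀ + G₁ a b * H₀ᵀ) →
      0 < N → 0 < d → (∃ X₀ : Matrix (Fin r) (Fin r) ℂ, (∑ a : Fin r, ∑ b : Fin r, X₀ a b • T a b).det ≠ 0) →
      ∃ Q : MvPolynomial (Fin r × Fin r) ℂ, Q ≠ 0 ∧
        complexity (Q * (∑ a : Fin r, ∑ b : Fin r, (MvPolynomial.X (a, b) : MvPolynomial (Fin r × Fin r) ℂ) • (T a b).map (MvPolynomial.C : ℂ → MvPolynomial (Fin r × Fin r) ℂ)).det) ≤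
          (∑ a : Fin r, ∑ b : Fin r, ((Finset.univ.filter fun p : Fin N × Fin d => G₁ a b p.1 p.2 ≠ 0).card + (Finset.univ.filter fun p : Fin N × Fin d => H₁ a b p.1 p.2 ≠ 0).card)) +
          4 * (10000 * (d + 1) ^ 2 * (Nat.log 2 N + 2) ^ 2 * 2 ^ (Nat.log 2 N + 1)))
    (hnil : ∀ (S : Type) [CommRing S] (N : ℕ) (A : Matrix (Fin N) (Fin N) S),
        A - (Matrix.of fun i j : Fin N => if (i : ℕ) = (j : ℕ) + 1 then (1 : S) else 0) * A *
          (Matrix.of fun i j : Fin N => if (i : ℕ) = (j : ℕ) + 1 then (1 : S) else 0)ᵀ = 0 → A = 0)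
    (hevalp : ∀ (r : ℕ) (m m' : Type) [Fintype m] [Fintype m'] (M : Fin r → Fin r → Matrix m m' ℂ) (x : Fin r × Fin r → ℂ),
        (∑ a : Fin r, ∑ b : Fin r, (MvPolynomial.X (a, b) : MvPolynomial (Fin r × Fin r) ℂ) • (M a b).map (MvPolynomial.C : ℂ → MvPolynomial (Fin r × Fin r) ℂ)).map (MvPolynomial.eval x) =
          ∑ a : Fin r, ∑ b : Fin r, x (a, b) • M a b) :
    ToeplitzLikeDetCost := by
  sorry

/-- **Composition.** The crux `ToeplitzLikeDetCost` from the registered stubs: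
`stub_final stub_core stub_pencilPad1.1 stub_pencilPad2.2.2` (the other registered stubs —
`stub_conversion`, `stub_mba`, `stub_normalise`, `stub_evalTransfer`, `stub_pencilPad1.2`,
`stub_pencilPad2.1/.2.1`, and the landed `stub_pairs`, `fftCost`, `stub_polyMulCost`,
`stub_cauchyMatvec`, `stub_cauchyAlgebra` — are consumed inside the proof of `stub_core`).
[cite: Pan2001, Cor. 5.3.3] -/
theorem ToeplitzLikeDetCost_of : ToeplitzLikeDetCost :=
  stub_final stub_core stub_pencilPad1.1 stub_pencilPad2.2.2

end

end Summit.MatrixMultiplication.MatrixMultiplication.Theorems
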